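/-
Copyright (c) 2026 the pub-hodgecm-mathlib formalisation cell (harness21).  Prover seat hodgecm-mathlib-K2E3-p23 (g6), HCML Track B «K2-LIT» ∕ h413
(`stmt-HodgeConjecture-24833`), line `K2_E3_EllipticInputs`, road «GL₂-sc» (road owner K2E5-p17 (g5), dealer K2E3-plan (g4)), NON-ELLIPTIC half, brick 2N-0a:
the `Fin 2` twin of ★ B4-0 file 2 `K2E3GL3HeightBallExhaustion` (K2E3-p14 (g5)).  2026-09-04.
-/
import Summits.HodgeConjecture.HodgeConjecture.Theorems.K2E3GL3HeightBallExhaustion        -- ★ B4-0 (K2E3-p14 g5): §1 generic compactness `isCompact_setOf_scaled_integral` (any `n`)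
import Summits.HodgeConjecture.HodgeConjecture.Theorems.K2E3GL2ModCocompactCentral         -- ★ (2F-b) p858773 (K2E5-p17 g5): `isCompact_image_center`, `normal_map_scalar` at `Fin 2`
import Literature.NumberTheory.Automorphic.ValuedFieldValuativeRelBridge                  -- ★ `mem_glInt_iff_forall_v_le_one`
import HarnessLib

/-!
# Road «GL₂-sc», non-elliptic half, brick 2N-0a: the scale-invariant HEIGHT-BALL compact exhaustion of `G_Λ = GL₂(F) ⧸ Λ₀·1`

Cell `pub/hodgecm-mathlib` (D-0151), Track B «K2-LIT», crux H413 = `stmt-HodgeConjecture-24833`, route of record `HCCMUnconditional`.  Lane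
`--supports stmt-HodgeConjecture-24833 --as helper`; THEOREMS ONLY (no `def`, no `instance`, no `notation`, no named-fact hypothesis, no `sorry`); count-neutral.

This is the `Fin 2` reading, token for token, of ★ `K2E3GL3HeightBallExhaustion` §2 (K2E3-p14 (g5), road «GL-[M6]-sc» B4-0): Harish-Chandra's truncated orbital
integrals `Θₙ(g) = ∫_{Ω n} θ(xgx⁻¹) dx` [HarishChandra1970, Part VII §2 p. 69, §3 p. 70] are taken along a compact exhaustion `Ω` of `G_Λ := GL₂(F) ⧸ Λ₀·1` by the
scale-invariant «Ad-height» balls of ★ `K2E3GLnAdHeightBalls` (generic `n`),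
  `𝔅_m(g) :≡ ∀ i j k l, |ϖ^m · g_{ij} · (g⁻¹)_{kl}| ≤ 1`   («`ϖ^m · Ad(g)` is integral»).
§1 of the `N = 3` file (compactness of `M_n(𝒪)`, of its scalings and of the GL-balls `{ϖ^a g, ϖ^b g⁻¹ integral}`) is generic in `n` and is IMPORTED, not restated.
§2 here: saturation (`preimage_mk_image_eq_of_scaleInvariant`), the image balls are open ∕ closed ∕ COMPACT (`isCompact_image_mk_setOf_adBall`: closed inside
`mk(C_m) · mk(Z)` by the generic normalisation and ★ (2F-b) `K2E3GL2ModCocompactCentral.isCompact_image_center`), and the payload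
**`exists_adHeightBall_compactExhaustion_quotScalar`**: a `CompactExhaustion Ω` of `G_Λ` with (i) `mk g ∈ Ω m ↔ 𝔅_m(g)`; (ii) `Ω m` open; (iii) `Ω m⁻¹ = Ω m`;
(iv) `Ω a · Ω b ⊆ Ω (a+b)`; (v) `K_Λ = mk(GL₂(𝒪))`-bi-invariance of every `Ω m`; (vi) `mk g ∈ Ω 0 ↔ ∃ k : ℤ, ϖ^k g ∈ GL₂(𝒪)`; (vii) `Ω 0 = K_Λ` when `ϖ ∈ Λ₀`;
(viii) the torus reading `mk (diag d) ∈ Ω m ↔ ∀ i j, |ϖ^m d_i∕d_j| ≤ 1`.  Every non-elliptic brick 2N-1…2N-7 of the road consumes exactly these eight clauses.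

HONEST LABEL: HC_CM is proved only modulo the 7 printed citations (2 remaining named inputs: hLiu418 = stmt-HodgeConjecture-24832, h413 =
stmt-HodgeConjecture-24833) until rung 0 closes; pure structure, count-neutral helper.

## References
* [HarishChandra1970] Harish-Chandra (notes by G. van Dijk), *Harmonic Analysis on Reductive p-adic Groups*, LNM 162 (1970), Part VII §2 p. 69 (`‖x‖`, `σ(x)`,
  `C_α`), §3 p. 70 (`Ω_T`, the passage to `G ⧸ Z`).
* [PlatonovRapinchuk1994] V. Platonov, A. Rapinchuk, *Algebraic Groups and Number Theory* (1994), §3.3 (`GL_n(𝒪_v)` compact open, `K^× = ϖ^ℤ × 𝒪^×`).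
* [Cartier1979] P. Cartier, *Representations of 𝔭-adic groups: a survey*, PSPM 33.1 (1979), §IV.1 (`K = GL_n(𝒪)`, heights).
-/

open Set Function Filter
open scoped MatrixGroups Pointwise WithZero Topology
open Matrix ValuativeRel
open Literature.NumberTheory.Automorphic Literature.NumberTheory.GaloisRepresentations Literature.NumberTheory.GaloisRepresentations.IsNonarchimedeanLocalField
open Summit.HodgeConjecture.HodgeConjecture.Cruxes.H413.K2E3GL2ModCocompactCentral Summit.HodgeConjecture.HodgeConjecture.Cruxes.H413.K2E3GLnAdHeightBalls
open Summit.HodgeConjecture.HodgeConjecture.Cruxes.H413.K2E3GL3HeightBallExhaustion (isCompact_setOf_scaled_integral)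

set_option linter.dupNamespace false

noncomputable section

namespace Summit.HodgeConjecture.HodgeConjecture.Cruxes.H413.K2E3GL2HeightBallExhaustion

/-! ## The exhaustion of `G_Λ = GL₂(F) ⧸ Λ₀·1` -/

section Quotient

variable {F : Type*} [Field F]

/-- **SATURATION**: for a SCALE-INVARIANT `S ⊆ GL₂(F)` and any `Λ₀ ≤ F^×`, `mk_Λ⁻¹(mk_Λ(S)) = S` (the kernel `Λ₀·1` consists of scalars). [folklore] -/
theorem preimage_mk_image_eq_of_scaleInvariant (Λ₀ : Subgroup Fˣ) {S : Set (GL (Fin 2) F)}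
    (hS : ∀ (c : Fˣ) (x : GL (Fin 2) F), x ∈ S → x * Matrix.GeneralLinearGroup.scalar (Fin 2) c ∈ S) :
    (QuotientGroup.mk : GL (Fin 2) F → GL (Fin 2) F ⧸ Λ₀.map (Matrix.GeneralLinearGroup.scalar (Fin 2))) ⁻¹' ((QuotientGroup.mk) '' S) = S := by
  ext x
  refine ⟨fun ⟨y, hy, hyx⟩ => ?_, fun hx => ⟨x, hx, rfl⟩⟩
  obtain ⟨c, -, hc⟩ := Subgroup.mem_map.1 (QuotientGroup.eq.1 hyx)
  have hx : x = y * Matrix.GeneralLinearGroup.scalar (Fin 2) c := by rw [hc, mul_inv_cancel_left]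
  rw [hx]
  exact hS c y hy

/-- Membership in the image of a scale-invariant set: `mk_Λ x ∈ mk_Λ(S) ↔ x ∈ S`. [folklore] -/
theorem mk_mem_image_iff_of_scaleInvariant (Λ₀ : Subgroup Fˣ) {S : Set (GL (Fin 2) F)}
    (hS : ∀ (c : Fˣ) (x : GL (Fin 2) F), x ∈ S → x * Matrix.GeneralLinearGroup.scalar (Fin 2) c ∈ S) (x : GL (Fin 2) F) :
    (QuotientGroup.mk x : GL (Fin 2) F ⧸ Λ₀.map (Matrix.GeneralLinearGroup.scalar (Fin 2))) ∈ (QuotientGroup.mk) '' S ↔ x ∈ S := by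
  rw [← Set.mem_preimage, preimage_mk_image_eq_of_scaleInvariant Λ₀ hS]

variable [Valued F ℤᵐ⁰] [ValuativeRel F] [(Valued.v : Valuation F ℤᵐ⁰).Compatible] [IsNonarchimedeanLocalField F]
  (Λ₀ : Subgroup Fˣ) [(Λ₀.map (Matrix.GeneralLinearGroup.scalar (Fin 2))).Normal]

omit [ValuativeRel F] [(Valued.v : Valuation F ℤᵐ⁰).Compatible] [IsNonarchimedeanLocalField F]
  [(Λ₀.map (Matrix.GeneralLinearGroup.scalar (Fin 2))).Normal] in
/-- The image ball `mk_Λ(𝔅_m)` is OPEN in `G_Λ`. [cite: Cartier1979, §IV.1] -/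
theorem isOpen_image_mk_setOf_adBall (ϖ : F) (m : ℕ) :
    IsOpen ((QuotientGroup.mk : GL (Fin 2) F → GL (Fin 2) F ⧸ Λ₀.map (Matrix.GeneralLinearGroup.scalar (Fin 2))) ''
      {g : GL (Fin 2) F | ∀ i j k l, Valued.v (ϖ ^ m * ((g : Matrix (Fin 2) (Fin 2) F) i j * ((g⁻¹ : GL (Fin 2) F) : Matrix (Fin 2) (Fin 2) F) k l)) ≤ 1}) :=
  QuotientGroup.isOpenMap_coe _ (isOpen_setOf_adBall ϖ m)

omit [ValuativeRel F] [(Valued.v : Valuation F ℤᵐ⁰).Compatible] [IsNonarchimedeanLocalField F]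
  [(Λ₀.map (Matrix.GeneralLinearGroup.scalar (Fin 2))).Normal] in
/-- The image ball `mk_Λ(𝔅_m)` is CLOSED in `G_Λ` (saturated closed set, quotient map). [cite: Cartier1979, §IV.1] -/
theorem isClosed_image_mk_setOf_adBall (ϖ : F) (m : ℕ) :
    IsClosed ((QuotientGroup.mk : GL (Fin 2) F → GL (Fin 2) F ⧸ Λ₀.map (Matrix.GeneralLinearGroup.scalar (Fin 2))) ''
      {g : GL (Fin 2) F | ∀ i j k l, Valued.v (ϖ ^ m * ((g : Matrix (Fin 2) (Fin 2) F) i j * ((g⁻¹ : GL (Fin 2) F) : Matrix (Fin 2) (Fin 2) F) k l)) ≤ 1}) := by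
  have hS : ∀ (c : Fˣ) (x : GL (Fin 2) F),
      x ∈ {g : GL (Fin 2) F | ∀ i j k l, Valued.v (ϖ ^ m * ((g : Matrix (Fin 2) (Fin 2) F) i j * ((g⁻¹ : GL (Fin 2) F) : Matrix (Fin 2) (Fin 2) F) k l)) ≤ 1} →
        x * Matrix.GeneralLinearGroup.scalar (Fin 2) c ∈
          {g : GL (Fin 2) F | ∀ i j k l, Valued.v (ϖ ^ m * ((g : Matrix (Fin 2) (Fin 2) F) i j * ((g⁻¹ : GL (Fin 2) F) : Matrix (Fin 2) (Fin 2) F) k l)) ≤ 1} :=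
    fun c x hx => (adBall_mul_scalar_iff ϖ m x c).2 hx
  refine (QuotientGroup.isQuotientMap_mk (Λ₀.map (Matrix.GeneralLinearGroup.scalar (Fin 2)))).isClosed_preimage.1 ?_
  rw [preimage_mk_image_eq_of_scaleInvariant Λ₀ hS]
  exact isClosed_setOf_adBall ϖ m

/-- **THE IMAGE BALL `mk_Λ(𝔅_m)` IS COMPACT** when `F^× ⧸ Λ₀` is compact: it is closed and contained in `mk_Λ(C_m) · mk_Λ(Z)` with `C_m` the compact GL-ball
(§1 normalisation `𝔅_m ⊆ ϖ^ℤ · C_m`) and `mk_Λ(Z)` compact ★ B0a. [cite: HarishChandra1970, Part VII §2 p. 69, §3 p. 70] -/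
theorem isCompact_image_mk_setOf_adBall {ϖ : F} (hϖ : Valued.v ϖ = WithZero.exp (-1 : ℤ)) [CompactSpace (Fˣ ⧸ Λ₀)] (m : ℕ) :
    IsCompact ((QuotientGroup.mk : GL (Fin 2) F → GL (Fin 2) F ⧸ Λ₀.map (Matrix.GeneralLinearGroup.scalar (Fin 2))) ''
      {g : GL (Fin 2) F | ∀ i j k l, Valued.v (ϖ ^ m * ((g : Matrix (Fin 2) (Fin 2) F) i j * ((g⁻¹ : GL (Fin 2) F) : Matrix (Fin 2) (Fin 2) F) k l)) ≤ 1}) := by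
  haveI : IsTopologicalRing F := inferInstance
  have hϖ0 : ϖ ≠ 0 := ne_zero_of_v_eq_exp hϖ
  -- the compact GL-ball `C_m`
  have hC : IsCompact {g : GL (Fin 2) F | (∀ i j, Valued.v (ϖ ^ 0 * (g : Matrix (Fin 2) (Fin 2) F) i j) ≤ 1) ∧
      ∀ i j, Valued.v (ϖ ^ m * ((g⁻¹ : GL (Fin 2) F) : Matrix (Fin 2) (Fin 2) F) i j) ≤ 1} := isCompact_setOf_scaled_integral hϖ0 0 m
  have hbig : IsCompact ((QuotientGroup.mk : GL (Fin 2) F → GL (Fin 2) F ⧸ Λ₀.map (Matrix.GeneralLinearGroup.scalar (Fin 2))) ''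
        {g : GL (Fin 2) F | (∀ i j, Valued.v (ϖ ^ 0 * (g : Matrix (Fin 2) (Fin 2) F) i j) ≤ 1) ∧
          ∀ i j, Valued.v (ϖ ^ m * ((g⁻¹ : GL (Fin 2) F) : Matrix (Fin 2) (Fin 2) F) i j) ≤ 1} *
      (QuotientGroup.mk : GL (Fin 2) F → GL (Fin 2) F ⧸ Λ₀.map (Matrix.GeneralLinearGroup.scalar (Fin 2))) ''
        (Subgroup.center (GL (Fin 2) F) : Set (GL (Fin 2) F))) :=
    (hC.image QuotientGroup.continuous_mk).mul (isCompact_image_center Λ₀)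
  refine hbig.of_isClosed_subset (isClosed_image_mk_setOf_adBall Λ₀ ϖ m) ?_
  rintro _ ⟨g, hg, rfl⟩
  obtain ⟨k, hk, hk'⟩ := exists_zpow_scalar_mul_integral_of_adBall hϖ hϖ0 hg
  -- `g = (ϖ^k g) · ϖ^{-k}·1`
  have hgeq : g = (Matrix.GeneralLinearGroup.scalar (Fin 2) (Units.mk0 ϖ hϖ0 ^ k) * g) * Matrix.GeneralLinearGroup.scalar (Fin 2) ((Units.mk0 ϖ hϖ0 ^ k)⁻¹) := by
    rw [map_inv, Matrix.GeneralLinearGroup.scalar_commute, mul_assoc, mul_inv_cancel, mul_one]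
  rw [hgeq, QuotientGroup.mk_mul]
  refine Set.mul_mem_mul ⟨_, ⟨fun i j => by rw [pow_zero, one_mul]; exact hk i j, hk'⟩, rfl⟩ ⟨_, ?_, rfl⟩
  rw [SetLike.mem_coe, Matrix.GeneralLinearGroup.center_eq_range_scalar]
  exact ⟨_, rfl⟩

/-- **THE SCALE-INVARIANT HEIGHT-BALL COMPACT EXHAUSTION OF `G_Λ = GL₂(F) ⧸ Λ₀·1`** (Harish-Chandra's `Ω_T = {1 + σ(Ad x) ≤ T}` for a group modulo a
cocompact central subgroup).  For a uniformizer `ϖ` and any `Λ₀ ≤ F^×` with `F^× ⧸ Λ₀` compact there is a `CompactExhaustion Ω` of `G_Λ` such that, writing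
`𝔅_m(g) :≡ ∀ i j k l, |ϖ^m g_{ij} (g⁻¹)_{kl}| ≤ 1`:
(i) `mk g ∈ Ω m ↔ 𝔅_m(g)`; (ii) every `Ω m` is OPEN; (iii) `x ∈ Ω m → x⁻¹ ∈ Ω m`; (iv) `Ω a · Ω b ⊆ Ω (a+b)` («`‖xy‖ ≤ ‖x‖‖y‖`»);
(v) every `Ω m` is BI-INVARIANT under `K_Λ = mk(GL₂(𝒪))`; (vi) `mk g ∈ Ω 0 ↔ ∃ k : ℤ, ϖ^k·g ∈ GL₂(𝒪)` (`Ω 0 = mk(ϖ^ℤ · GL₂(𝒪))`);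
(vii) if `ϖ ∈ Λ₀` (e.g. `Λ₀ = ϖ^ℤ`) then `Ω 0 = K_Λ` exactly; (viii) the TORUS READING `mk t ∈ Ω m ↔ ∀ i j, |ϖ^m d_i∕d_j| ≤ 1` for `t = diag(d)`.
Monotonicity, covering, measurability (`Ω m` compact, hence closed) and `exists_superset_of_isCompact` are the Mathlib `CompactExhaustion` API.
[cite: HarishChandra1970, Part VII §2 p. 69, §3 p. 70] [cite: PlatonovRapinchuk1994, §3.3] [cite: Cartier1979, §IV.1] -/
theorem exists_adHeightBall_compactExhaustion_quotScalar {ϖ : F} (hϖ : Valued.v ϖ = WithZero.exp (-1 : ℤ)) (hϖ0 : ϖ ≠ 0)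
    [CompactSpace (Fˣ ⧸ Λ₀)] :
    ∃ Ω : CompactExhaustion (GL (Fin 2) F ⧸ Λ₀.map (Matrix.GeneralLinearGroup.scalar (Fin 2))),
      (∀ (m : ℕ) (g : GL (Fin 2) F), (QuotientGroup.mk g : GL (Fin 2) F ⧸ Λ₀.map (Matrix.GeneralLinearGroup.scalar (Fin 2))) ∈ Ω m ↔
        ∀ i j k l, Valued.v (ϖ ^ m * ((g : Matrix (Fin 2) (Fin 2) F) i j * ((g⁻¹ : GL (Fin 2) F) : Matrix (Fin 2) (Fin 2) F) k l)) ≤ 1) ∧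
      (∀ m : ℕ, IsOpen (Ω m)) ∧
      (∀ (m : ℕ) (x : GL (Fin 2) F ⧸ Λ₀.map (Matrix.GeneralLinearGroup.scalar (Fin 2))), x ∈ Ω m → x⁻¹ ∈ Ω m) ∧
      (∀ (a b : ℕ) (x y : GL (Fin 2) F ⧸ Λ₀.map (Matrix.GeneralLinearGroup.scalar (Fin 2))), x ∈ Ω a → y ∈ Ω b → x * y ∈ Ω (a + b)) ∧
      (∀ (m : ℕ) (k : GL (Fin 2) F), k ∈ glInt 2 F → ∀ x : GL (Fin 2) F ⧸ Λ₀.map (Matrix.GeneralLinearGroup.scalar (Fin 2)),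
        ((QuotientGroup.mk k : GL (Fin 2) F ⧸ Λ₀.map (Matrix.GeneralLinearGroup.scalar (Fin 2))) * x ∈ Ω m ↔ x ∈ Ω m) ∧
          (x * (QuotientGroup.mk k : GL (Fin 2) F ⧸ Λ₀.map (Matrix.GeneralLinearGroup.scalar (Fin 2))) ∈ Ω m ↔ x ∈ Ω m)) ∧
      (∀ g : GL (Fin 2) F, (QuotientGroup.mk g : GL (Fin 2) F ⧸ Λ₀.map (Matrix.GeneralLinearGroup.scalar (Fin 2))) ∈ Ω 0 ↔
        ∃ k : ℤ, Matrix.GeneralLinearGroup.scalar (Fin 2) (Units.mk0 ϖ hϖ0 ^ k) * g ∈ glInt 2 F) ∧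
      (Units.mk0 ϖ hϖ0 ∈ Λ₀ → ∀ x : GL (Fin 2) F ⧸ Λ₀.map (Matrix.GeneralLinearGroup.scalar (Fin 2)),
        x ∈ Ω 0 ↔ x ∈ ((glInt 2 F).map (QuotientGroup.mk' (Λ₀.map (Matrix.GeneralLinearGroup.scalar (Fin 2)))) :
          Set (GL (Fin 2) F ⧸ Λ₀.map (Matrix.GeneralLinearGroup.scalar (Fin 2))))) ∧
      (∀ (m : ℕ) (t : GL (Fin 2) F) (d : Fin 2 → F), (t : Matrix (Fin 2) (Fin 2) F) = Matrix.diagonal d →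
        ((QuotientGroup.mk t : GL (Fin 2) F ⧸ Λ₀.map (Matrix.GeneralLinearGroup.scalar (Fin 2))) ∈ Ω m ↔
          ∀ i j, Valued.v (ϖ ^ m * (d i * (d j)⁻¹)) ≤ 1)) := by
  have hϖ1 : Valued.v ϖ ≤ 1 := v_le_one_of_v_eq_exp hϖ
  -- the balls upstairs and their images
  let B : ℕ → Set (GL (Fin 2) F) := fun m =>
    {g : GL (Fin 2) F | ∀ i j k l, Valued.v (ϖ ^ m * ((g : Matrix (Fin 2) (Fin 2) F) i j * ((g⁻¹ : GL (Fin 2) F) : Matrix (Fin 2) (Fin 2) F) k l)) ≤ 1}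
  have hBmem : ∀ m g, g ∈ B m ↔
      ∀ i j k l, Valued.v (ϖ ^ m * ((g : Matrix (Fin 2) (Fin 2) F) i j * ((g⁻¹ : GL (Fin 2) F) : Matrix (Fin 2) (Fin 2) F) k l)) ≤ 1 := fun m g => Iff.rfl
  have hBsc : ∀ (m : ℕ) (c : Fˣ) (x : GL (Fin 2) F), x ∈ B m → x * Matrix.GeneralLinearGroup.scalar (Fin 2) c ∈ B m :=
    fun m c x hx => (adBall_mul_scalar_iff ϖ m x c).2 hx
  let Ω₀ : ℕ → Set (GL (Fin 2) F ⧸ Λ₀.map (Matrix.GeneralLinearGroup.scalar (Fin 2))) := fun m =>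
    (QuotientGroup.mk : GL (Fin 2) F → GL (Fin 2) F ⧸ Λ₀.map (Matrix.GeneralLinearGroup.scalar (Fin 2))) '' B m
  have hmem : ∀ (m : ℕ) (g : GL (Fin 2) F), (QuotientGroup.mk g : GL (Fin 2) F ⧸ Λ₀.map (Matrix.GeneralLinearGroup.scalar (Fin 2))) ∈ Ω₀ m ↔
      ∀ i j k l, Valued.v (ϖ ^ m * ((g : Matrix (Fin 2) (Fin 2) F) i j * ((g⁻¹ : GL (Fin 2) F) : Matrix (Fin 2) (Fin 2) F) k l)) ≤ 1 :=
    fun m g => mk_mem_image_iff_of_scaleInvariant Λ₀ (hBsc m) g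
  have hopen : ∀ m, IsOpen (Ω₀ m) := fun m => isOpen_image_mk_setOf_adBall Λ₀ ϖ m
  have hcpt : ∀ m, IsCompact (Ω₀ m) := fun m => isCompact_image_mk_setOf_adBall Λ₀ hϖ m
  have hmono : ∀ m, Ω₀ m ⊆ Ω₀ (m + 1) := fun m => Set.image_mono fun g hg => adBall_succ hϖ1 hg
  have hcov : ∀ x : GL (Fin 2) F ⧸ Λ₀.map (Matrix.GeneralLinearGroup.scalar (Fin 2)), ∃ m, x ∈ Ω₀ m := by
    intro x
    obtain ⟨g, rfl⟩ := QuotientGroup.mk_surjective x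
    obtain ⟨m, hm⟩ := exists_adBall hϖ g
    exact ⟨m, (hmem m g).2 hm⟩
  refine ⟨⟨Ω₀, hcpt, fun m => ?_, ?_⟩, hmem, hopen, fun m x hx => ?_, fun a b x y hx hy => ?_, fun m k hk x => ?_, fun g => ?_, fun hΛ x => ?_,
    fun m t d ht => ?_⟩
  · -- `Ω m ⊆ interior (Ω (m+1))`
    rw [(hopen (m + 1)).interior_eq]
    exact hmono m
  · exact Set.eq_univ_of_forall fun x => Set.mem_iUnion.2 (hcov x)
  · -- (iii) inversion
    obtain ⟨g, rfl⟩ := QuotientGroup.mk_surjective x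
    change (QuotientGroup.mk g : GL (Fin 2) F ⧸ Λ₀.map (Matrix.GeneralLinearGroup.scalar (Fin 2))) ∈ Ω₀ m at hx
    change (QuotientGroup.mk g : GL (Fin 2) F ⧸ Λ₀.map (Matrix.GeneralLinearGroup.scalar (Fin 2)))⁻¹ ∈ Ω₀ m
    rw [← QuotientGroup.mk_inv, hmem]
    exact adBall_inv ((hmem m g).1 hx)
  · -- (iv) products
    obtain ⟨g, rfl⟩ := QuotientGroup.mk_surjective x
    obtain ⟨h, rfl⟩ := QuotientGroup.mk_surjective y
    change (QuotientGroup.mk g : GL (Fin 2) F ⧸ Λ₀.map (Matrix.GeneralLinearGroup.scalar (Fin 2))) ∈ Ω₀ a at hx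
    change (QuotientGroup.mk h : GL (Fin 2) F ⧸ Λ₀.map (Matrix.GeneralLinearGroup.scalar (Fin 2))) ∈ Ω₀ b at hy
    change (QuotientGroup.mk g : GL (Fin 2) F ⧸ Λ₀.map (Matrix.GeneralLinearGroup.scalar (Fin 2))) * QuotientGroup.mk h ∈ Ω₀ (a + b)
    rw [← QuotientGroup.mk_mul, hmem]
    exact adBall_mul ((hmem a g).1 hx) ((hmem b h).1 hy)
  · -- (v) `K_Λ`-bi-invariance
    obtain ⟨hk1, hk2⟩ := (mem_glInt_iff_forall_v_le_one k).1 hk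
    obtain ⟨g, rfl⟩ := QuotientGroup.mk_surjective x
    change ((QuotientGroup.mk k : GL (Fin 2) F ⧸ Λ₀.map (Matrix.GeneralLinearGroup.scalar (Fin 2))) * QuotientGroup.mk g ∈ Ω₀ m ↔
        (QuotientGroup.mk g : GL (Fin 2) F ⧸ Λ₀.map (Matrix.GeneralLinearGroup.scalar (Fin 2))) ∈ Ω₀ m) ∧
      ((QuotientGroup.mk g : GL (Fin 2) F ⧸ Λ₀.map (Matrix.GeneralLinearGroup.scalar (Fin 2))) * QuotientGroup.mk k ∈ Ω₀ m ↔
        (QuotientGroup.mk g : GL (Fin 2) F ⧸ Λ₀.map (Matrix.GeneralLinearGroup.scalar (Fin 2))) ∈ Ω₀ m)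
    rw [← QuotientGroup.mk_mul, ← QuotientGroup.mk_mul, hmem, hmem, hmem]
    exact ⟨adBall_mul_left_iff ϖ m hk1 hk2 g, adBall_mul_right_iff ϖ m hk1 hk2 g⟩
  · -- (vi) `Ω 0 = mk(ϖ^ℤ · GL₂(𝒪))`
    change (QuotientGroup.mk g : GL (Fin 2) F ⧸ Λ₀.map (Matrix.GeneralLinearGroup.scalar (Fin 2))) ∈ Ω₀ 0 ↔ _
    rw [hmem, adBall_zero_iff_exists_zpow_scalar_mul_integral hϖ hϖ0]
    simp only [mem_glInt_iff_forall_v_le_one]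
  · -- (vii) `Ω 0 = K_Λ` when `ϖ ∈ Λ₀`
    obtain ⟨g, rfl⟩ := QuotientGroup.mk_surjective x
    change (QuotientGroup.mk g : GL (Fin 2) F ⧸ Λ₀.map (Matrix.GeneralLinearGroup.scalar (Fin 2))) ∈ Ω₀ 0 ↔ _
    rw [hmem, SetLike.mem_coe, Subgroup.mem_map]
    constructor
    · intro h0
      obtain ⟨k, hk1, hk2⟩ := (adBall_zero_iff_exists_zpow_scalar_mul_integral hϖ hϖ0 g).1 h0
      refine ⟨Matrix.GeneralLinearGroup.scalar (Fin 2) (Units.mk0 ϖ hϖ0 ^ k) * g, (mem_glInt_iff_forall_v_le_one _).2 ⟨hk1, hk2⟩, ?_⟩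
      have h1 : (QuotientGroup.mk (Matrix.GeneralLinearGroup.scalar (Fin 2) (Units.mk0 ϖ hϖ0 ^ k)) :
          GL (Fin 2) F ⧸ Λ₀.map (Matrix.GeneralLinearGroup.scalar (Fin 2))) = 1 := by
        rw [QuotientGroup.eq_one_iff]
        exact Subgroup.mem_map_of_mem _ (Subgroup.zpow_mem Λ₀ hΛ k)
      rw [QuotientGroup.mk'_apply, QuotientGroup.mk_mul, h1, one_mul]
    · rintro ⟨u, hu, hux⟩
      rw [QuotientGroup.mk'_apply] at hux
      obtain ⟨c, -, hcu⟩ := Subgroup.mem_map.1 (QuotientGroup.eq.1 hux)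
      -- `g = u · c·1` with `u ∈ GL₂(𝒪)`: so `𝔅_0(g)` by scale invariance
      have hg : g = u * Matrix.GeneralLinearGroup.scalar (Fin 2) c := by rw [hcu, mul_inv_cancel_left]
      rw [hg]
      exact (adBall_mul_scalar_iff ϖ 0 u c).2
        (adBall_zero_of_forall_v_le_one ϖ ((mem_glInt_iff_forall_v_le_one u).1 hu).1 ((mem_glInt_iff_forall_v_le_one u).1 hu).2)
  · -- (viii) the torus reading
    change (QuotientGroup.mk t : GL (Fin 2) F ⧸ Λ₀.map (Matrix.GeneralLinearGroup.scalar (Fin 2))) ∈ Ω₀ m ↔ _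
    rw [hmem]
    exact adBall_iff_of_coe_eq_diagonal ϖ m ht

end Quotient

end Summit.HodgeConjecture.HodgeConjecture.Cruxes.H413.K2E3GL2HeightBallExhaustion

end
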